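import Summits.ResolutionOfSingularities.ResolutionOfSingularities.Theorems.FrobeniusLadderFInjectiveMacaulayficationGermOfGlobalBlowup
import Summits.ResolutionOfSingularities.ResolutionOfSingularities.Theorems.FrobeniusLadderFInjectiveMacaulayficationLocalBlowupDesingularizationDimThree
import Summits.ResolutionOfSingularities.ResolutionOfSingularities.Theorems.FrobeniusLadderFInjectiveMacaulayficationP2d4CChar2Germ
import Summits.ResolutionOfSingularities.ResolutionOfSingularities.Theorems.FrobeniusLadderFInjectiveMacaulayficationFCentreE1ChartPresentation
import Literature.AlgebraicGeometry.Resolution.BlowupsProduct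
import Literature.AlgebraicGeometry.Resolution.BlowupsScaling
import Literature.AlgebraicGeometry.Resolution.MarkedIdealsLemmas
import HarnessLib

/-!
# F4POS-2b: THE F-HALF'S CONCLUSION FOR A NON-TRIVIAL INPUT `S′ = Bl_τ` FROM A FULL BLOWING UP ALONG A PRODUCT CENTRE `τ·K`
# (crux `FInjectiveMacaulayfication` stmt-ResolutionOfSingularities-15315, chain w45a; res-L1-w45a-plan-1 R18.12/R18.13 «F4POS-2b → stub-3», shape l.79568;
# res-L1-w45a-tri-2 first-step read 08:33:00Z (product-centre recommendation, API names); seat res-L1-w45a-stub-3 g9)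

[OURS · L1 W4.5a] Support file (`--supports stmt-ResolutionOfSingularities-15315 --as helper`); replaces the role of NO printed item; NOT a statement of any
manuscript; def-free; §1–§2 UNCONDITIONAL, §3 conditional on ONE hypothesis `hrow` (= res-L1-w45a-stub-2's F4POS-2a certificate row for the product centre, to
be discharged by name when it lands). AI-written (AI review is weaker than expert review).

WHAT. The F-half `LocalFInjectivizationFibreAdmGe4` concludes, for an admissible local blow-up `g : S′ → Spec 𝒪_{X,x}` along `I`: `∃ 𝓚 ≠ ⊥` on `S′`, supported over the
closed point, ALL of whose blowings up are FULL at every stalk. So far every kernel row had the trivial input `S′ = Spec 𝒪_{X,x}` (F(4)-iso). This file supplies the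
plumbing for the FIRST F(4)-pos ROW (input `S′ = Bl_τ X` at the P2d4C vertex, whose non-FULL locus is 3-dimensional — res-L1-w45a-stub-2 p615290):
* §1 ★ `fHalfConclusion_of_isBlowup_mul` — GENERIC: if `π₂ : X₂ → X` is a blowing up along a PRODUCT `Jτ * JK` (`≠ ⊥`, `X` integral) which is FULL at every point over
  a generization of `x`, and `Supp JK` meets the generizations of `x` only in `x`, then the F-half's conclusion holds for EVERY blowing up `g : S′ → Spec 𝒪_{X,x}` along
  `Jτ·𝒪_{X,x}`, with `𝓚 := (JK·𝒪_{X,x})·𝒪_{S′}`: every blowing up `π : S″ → S′` along `𝓚` satisfies `IsBlowup (π ≫ g) ((Jτ * JK)·𝒪_{X,x})` (Stacks 080A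
  `IsBlowup.comp` + `comap_mul`), hence is isomorphic (`IsBlowup.unique`) to the flat pull-back `X₂ ×_X Spec 𝒪_{X,x}` (`IsBlowup.pullback_snd_of_flat`), whose
  stalks are stalks of `X₂` over generizations of `x` — FULL. `𝓚 ≠ ⊥` because that pull-back is integral (non-empty) while a blowing up along `⊥` is empty — no
  «comap ≠ ⊥ along a blow-up» lemma is needed.
* §2 ★ `fHalfConclusion_of_affineBlowup_mul` — AFFINE FORM: `A` a domain, `τ, K ≠ ⊥` ideals, `v ∈ Spec A` with `v ⊆ √K`, and `Bl_{τK}(Spec A) = affineBlowup (τ * K)`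
  FULL at every point ⇒ the F-half's conclusion for every blowing up of `Spec 𝒪_{Spec A, v}` along `τ·𝒪`.
* §3 `tauFloor_P2d4C_cure` — THE P2d4C LETTERING (`X = V(z² + x⁴z + y³ + u³ + t³) ⊂ 𝔸⁵`, char 2, `v` = vertex, `τ = (x̄², ȳ, ū, t̄, z̄)`): for EVERY `𝔪_v`-primary
  `K` such that `affineBlowup (τ * K)` is FULL at every point (hypothesis `hrow` = res-L1-w45a-stub-2's F4POS-2a row on the product centre; res-L1-w45a-idea-1's
  factor `K` of the clean fan, cert 6984e77c8fc6f0f1 / ada44c2874c63a18), the F-half's conclusion holds for every `S′ → Spec 𝒪_{X,v}` blowing up `τ·𝒪_{X,v}`.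
CENSUS NOTE (res-L1-w45a-tri-2): the OUTPUT here is formally an iso-currency fact about `X` at `v` (centre `τK`); what makes the ROW «F(4)-pos POSITIVE #1» is the INPUT
legality of `S′ = Bl_τ X` (non-FULL along a 3-fold, p615290; CM charts, admissibility, regular off the fibre: F4POS-1) + this composition. `k`: any field of char 2.
[folklore assembly; cite: StacksProject, Tag 080A; Tag 01OG] [cite: GortzWedhorn2020, Def. 13.90, (13.19), Prop. 13.91 (2)] [cite: Temkin2008, §2.1]
-/

-- single-problem summit: the doubled namespace component is forced
set_option linter.dupNamespace false

noncomputable section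

namespace Summit.ResolutionOfSingularities.ResolutionOfSingularities.Theorems.FInjectiveMacaulayfication.FHalfRowOfProductCentre

open CategoryTheory CategoryTheory.Limits AlgebraicGeometry TopologicalSpace IsLocalRing MvPolynomial
open Literature.AlgebraicGeometry.Resolution
open Summit.ResolutionOfSingularities.ResolutionOfSingularities.Theorems.FInjectiveMacaulayfication
open SliceableCentre GermOfGlobalBlowup

/-! ## §1 Generic: a FULL blowing up along `Jτ * JK` gives the F-half's conclusion for every local blowing up along `Jτ` -/

/-- ★ **The F-half's conclusion for the input `Bl_{Jτ}` from a FULL blowing up along the product `Jτ * JK`.** See the module docstring.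
[folklore assembly; cite: StacksProject, Tag 080A] [cite: GortzWedhorn2020, (13.19); Prop. 13.91 (2)] -/
theorem fHalfConclusion_of_isBlowup_mul (p : ℕ) {X X₂ : Scheme.{0}} [IsIntegral X] (x : X) {π₂ : X₂ ⟶ X} {Jτ JK : X.IdealSheafData}
    (hπ₂ : IsBlowup π₂ (Jτ * JK)) (hJ : Jτ * JK ≠ ⊥)
    (hsupp : ∀ y ∈ (JK.support : Set X), y ⤳ x → y = x)
    (hfull : ∀ x₂ : X₂, π₂.base x₂ ⤳ x → FullCl p (X₂.presheaf.stalk x₂)) :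
    ∀ (S' : Scheme.{0}) (g : S' ⟶ Spec (X.presheaf.stalk x)), IsBlowup g (Jτ.comap (X.fromSpecStalk x)) →
      ∃ 𝓚 : S'.IdealSheafData, 𝓚 ≠ ⊥ ∧ (∀ s ∈ (𝓚.support : Set S'), g.base s = closedPoint (X.presheaf.stalk x)) ∧
        ∀ (S'' : Scheme.{0}) (π : S'' ⟶ S'), IsBlowup π 𝓚 → ∀ s : S'', FullCl p (S''.presheaf.stalk s) := by
  intro S' g hg
  haveI : Flat (X.fromSpecStalk x) := flat_fromSpecStalk X x
  -- the flat pull-back `P = X₂ ×_X Spec 𝒪_{X,x}`, a blowing up along `(Jτ JK)·𝒪_{X,x}`, integral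
  have hP : IsBlowup (pullback.snd π₂ (X.fromSpecStalk x)) ((Jτ * JK).comap (X.fromSpecStalk x)) :=
    hπ₂.pullback_snd_of_flat (X.fromSpecStalk x)
  haveI : IsIntegral (pullback π₂ (X.fromSpecStalk x)) := hP.isIntegral (comap_fromSpecStalk_ne_bot hJ x)
  refine ⟨(JK.comap (X.fromSpecStalk x)).comap g, ?_, ?_, ?_⟩
  · -- `𝓚 ≠ ⊥`: a blowing up along `𝓚` is isomorphic to the non-empty `P`
    intro h0
    obtain ⟨S'', π, hπ⟩ := exists_isBlowup S' ((JK.comap (X.fromSpecStalk x)).comap g)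
    have hcomp : IsBlowup (π ≫ g) ((Jτ * JK).comap (X.fromSpecStalk x)) := by
      rw [comap_mul]
      exact hg.comp hπ
    obtain ⟨e, -, -⟩ := hcomp.unique hP
    rw [h0] at hπ
    haveI := LocalBlowupDesingularizationDimThree.isEmpty_of_isBlowup_bot hπ
    obtain ⟨t⟩ := (inferInstance : Nonempty ↑(pullback π₂ (X.fromSpecStalk x)))
    exact IsEmpty.false (e.inv t)
  · -- support over the closed point
    intro s hs
    rw [Scheme.IdealSheafData.support_comap] at hs
    exact support_comap_fromSpecStalk_subset_closedPoint JK x hsupp _ hs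
  · -- every blowing up along `𝓚` is FULL: it is `P` up to isomorphism, and `P`'s stalks are stalks of `X₂` over generizations of `x`
    intro S'' π hπ s
    have hcomp : IsBlowup (π ≫ g) ((Jτ * JK).comap (X.fromSpecStalk x)) := by
      rw [comap_mul]
      exact hg.comp hπ
    obtain ⟨e, -, -⟩ := hcomp.unique hP
    haveI := isIso_stalkMap_of_flat_of_isPreimmersion e.hom s
    refine FTemkinClosedPoints.fullCl_of_isIso_stalkMap' p e.hom s ?_
    set t := e.hom s with ht
    haveI := isIso_stalkMap_pullback_fst_fromSpecStalk π₂ x t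
    refine FTemkinClosedPoints.fullCl_of_isIso_stalkMap' p (pullback.fst π₂ (X.fromSpecStalk x)) t (hfull _ ?_)
    have hmem : (pullback.fst π₂ (X.fromSpecStalk x)) t ∈ Set.range (pullback.fst π₂ (X.fromSpecStalk x)) := ⟨t, rfl⟩
    rw [range_pullback_fst_fromSpecStalk] at hmem
    exact hmem

/-! ## §2 Affine form -/

/-- ★ **Affine form**: `A` a domain, `τ, K ≠ ⊥` ideals of `A`, `v ∈ Spec A` with `v ⊆ √K` (so `V(K)` meets the generizations of `v` only in `v`), and the affine blowing
up `Bl_{τK}(Spec A) = affineBlowup (τ * K)` FULL at every point. Then the F-half's conclusion holds for every blowing up of `Spec 𝒪_{Spec A,v}` along `τ·𝒪`.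
[folklore assembly; cite: GortzWedhorn2020, Prop. 13.92; (13.19)] [cite: StacksProject, Tag 080A] -/
theorem fHalfConclusion_of_affineBlowup_mul (p : ℕ) {A : Type} [CommRing A] [IsDomain A] (τ K : Ideal A) (hτ : τ ≠ ⊥) (hK : K ≠ ⊥)
    (v : Spec (.of A)) (hvK : v.asIdeal ≤ K.radical)
    (hrow : ∀ y : ↥(affineBlowup (τ * K)), FullCl p ((affineBlowup (τ * K)).presheaf.stalk y)) :
    ∀ (S' : Scheme.{0}) (g : S' ⟶ Spec ((Spec (.of A)).presheaf.stalk v)),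
      IsBlowup g ((affineBlowup.idealSheaf τ).comap ((Spec (.of A)).fromSpecStalk v)) →
      ∃ 𝓚 : S'.IdealSheafData, 𝓚 ≠ ⊥ ∧ (∀ s ∈ (𝓚.support : Set S'), g.base s = closedPoint ((Spec (.of A)).presheaf.stalk v)) ∧
        ∀ (S'' : Scheme.{0}) (π : S'' ⟶ S'), IsBlowup π 𝓚 → ∀ s : S'', FullCl p (S''.presheaf.stalk s) := by
  have hπ : IsBlowup (affineBlowup.π (τ * K)) (affineBlowup.idealSheaf τ * affineBlowup.idealSheaf K) := by
    rw [← affineBlowup.idealSheaf_mul]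
    exact affineBlowup.isBlowup (τ * K)
  have hJ : affineBlowup.idealSheaf τ * affineBlowup.idealSheaf K ≠ ⊥ := by
    rw [← affineBlowup.idealSheaf_mul]
    exact affineBlowup.idealSheaf_ne_bot (mul_ne_zero hτ hK)
  refine fHalfConclusion_of_isBlowup_mul p v hπ hJ ?_ fun y _ => hrow y
  intro y hy hyv
  rw [affineBlowup.support_idealSheaf] at hy
  have hKy : K ≤ y.asIdeal := fun a ha => hy ha
  have h1 : v.asIdeal ≤ y.asIdeal := hvK.trans (y.2.radical_le_iff.mpr hKy)
  have h2 : y.asIdeal ≤ v.asIdeal := (PrimeSpectrum.le_iff_specializes y v).mpr hyv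
  exact PrimeSpectrum.ext (le_antisymm h2 h1)

/-! ## §3 The P2d4C lettering: the τ-floor cured by the product centre -/

/-- **F4POS-2b (the τ-floor of P2d4C cured), modulo the F4POS-2a certificate row `hrow`.** `X = Spec (k[X0..X4]/(f))`, `f = X4² + X0⁴X4 + X1³ + X2³ + X3³`, `char k = 2`
(any field), `v` = the vertex, `τ = (x̄0², x̄1, x̄2, x̄3, x̄4)` (res-L1-w45a-plan-1's test-ideal centre, TAU-PROBE); `K` = any nonzero ideal with `𝔪_v = (x̄0,…,x̄4) ⊆ √K` whose
PRODUCT blowing up `affineBlowup (τ * K)` is FULL at every point (for res-L1-w45a-idea-1's 22-monomial factor `K` of the clean fan this is res-L1-w45a-stub-2's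
F4POS-2a row). THEN: for EVERY blowing up `g : S′ → Spec 𝒪_{X,v}` along `τ·𝒪_{X,v}` — the τ-floor in the F-half's literal input currency — there is `𝓚 ≠ ⊥` on `S′`,
supported over the closed point, ALL of whose blowings up are FULL at every stalk: the F-half's conclusion at `(d, p, X, x, S′, g, I) = (4, 2, P2d4C, v, S′, g, τ·𝒪)`.
The input legality (admissible, regular off the fibre, CM, NOT FULL along a 3-fold) is F4POS-1 (p615290, …), not assumed here. [OURS · conditional on `hrow`]
[cite: StacksProject, Tag 080A] [cite: GortzWedhorn2020, Prop. 13.92] -/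
theorem tauFloor_P2d4C_cure (k : Type) [Field k] [CharP k 2] (f : MvPolynomial (Fin 5) k)
    (hf : f = X 4 ^ 2 + X 0 ^ 4 * X 4 + X 1 ^ 3 + X 2 ^ 3 + X 3 ^ 3)
    (v : Spec (.of (MvPolynomial (Fin 5) k ⧸ Ideal.span {f})))
    (hv : v.asIdeal = Ideal.span (Set.range fun j : Fin 5 => Ideal.Quotient.mk (Ideal.span {f}) (X j)))
    (K : Ideal (MvPolynomial (Fin 5) k ⧸ Ideal.span {f})) (hK : K ≠ ⊥)
    (hmK : Ideal.span (Set.range fun j : Fin 5 => Ideal.Quotient.mk (Ideal.span {f}) (X j)) ≤ K.radical)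
    (hrow : ∀ y : ↥(affineBlowup
        (Ideal.span {Ideal.Quotient.mk (Ideal.span {f}) (X 0) ^ 2, Ideal.Quotient.mk (Ideal.span {f}) (X 1),
          Ideal.Quotient.mk (Ideal.span {f}) (X 2), Ideal.Quotient.mk (Ideal.span {f}) (X 3), Ideal.Quotient.mk (Ideal.span {f}) (X 4)} * K)),
      FullCl 2 ((affineBlowup
        (Ideal.span {Ideal.Quotient.mk (Ideal.span {f}) (X 0) ^ 2, Ideal.Quotient.mk (Ideal.span {f}) (X 1),
          Ideal.Quotient.mk (Ideal.span {f}) (X 2), Ideal.Quotient.mk (Ideal.span {f}) (X 3), Ideal.Quotient.mk (Ideal.span {f}) (X 4)} * K)).presheaf.stalk y)) :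
    ∀ (S' : Scheme.{0}) (g : S' ⟶ Spec ((Spec (.of (MvPolynomial (Fin 5) k ⧸ Ideal.span {f}))).presheaf.stalk v)),
      IsBlowup g ((affineBlowup.idealSheaf
        (Ideal.span {Ideal.Quotient.mk (Ideal.span {f}) (X 0) ^ 2, Ideal.Quotient.mk (Ideal.span {f}) (X 1),
          Ideal.Quotient.mk (Ideal.span {f}) (X 2), Ideal.Quotient.mk (Ideal.span {f}) (X 3), Ideal.Quotient.mk (Ideal.span {f}) (X 4)})).comap
        ((Spec (.of (MvPolynomial (Fin 5) k ⧸ Ideal.span {f}))).fromSpecStalk v)) →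
      ∃ 𝓚 : S'.IdealSheafData, 𝓚 ≠ ⊥ ∧
        (∀ s ∈ (𝓚.support : Set S'), g.base s = closedPoint ((Spec (.of (MvPolynomial (Fin 5) k ⧸ Ideal.span {f}))).presheaf.stalk v)) ∧
        ∀ (S'' : Scheme.{0}) (π : S'' ⟶ S'), IsBlowup π 𝓚 → ∀ s : S'', FullCl 2 (S''.presheaf.stalk s) := by
  classical
  haveI hfprime : (Ideal.span {f}).IsPrime :=
    (Ideal.span_singleton_prime (FCentreE1ChartWitness.prime_f k f hf).ne_zero).mpr (FCentreE1ChartWitness.prime_f k f hf)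
  haveI : IsDomain (MvPolynomial (Fin 5) k ⧸ Ideal.span {f}) := Ideal.Quotient.isDomain _
  refine fHalfConclusion_of_affineBlowup_mul 2 _ K ?_ hK v (by rw [hv]; exact hmK) hrow
  -- `τ ≠ ⊥`: it contains `x̄1 ≠ 0` (res-L1-w45a-stub-1's `FCentreE1ChartPresentation.mk_X_ne_zero`)
  intro h0
  have hmem : Ideal.Quotient.mk (Ideal.span {f}) (X 1 : MvPolynomial (Fin 5) k) ∈
      Ideal.span {Ideal.Quotient.mk (Ideal.span {f}) (X 0) ^ 2, Ideal.Quotient.mk (Ideal.span {f}) (X 1),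
        Ideal.Quotient.mk (Ideal.span {f}) (X 2), Ideal.Quotient.mk (Ideal.span {f}) (X 3), Ideal.Quotient.mk (Ideal.span {f}) (X 4)} :=
    Ideal.subset_span (by simp)
  rw [h0, Ideal.mem_bot] at hmem
  exact (FCentreE1ChartPresentation.mk_X_ne_zero k f hf).2 hmem

end Summit.ResolutionOfSingularities.ResolutionOfSingularities.Theorems.FInjectiveMacaulayfication.FHalfRowOfProductCentre

end
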